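import Summits.Ventures.HodgeRepro2.T5LandherrGeneralHM
import Summits.Ventures.HodgeRepro2.T5LandherrOfHasseMinkowskiGeneral
import Summits.Ventures.HodgeRepro2.T5LandherrOfHasseMinkowski

/-!
# The consumers of Landherr's theorem on the Hasse–Minkowski display ALONE: Shimura's Theorem 2.2 (i), the
general-rank Gram-form statements, Lemma N.2's conclusions (cell pub-hodge-repro2, seat p3)

Tier-5 N2 support, rows N2.2.7 / N2.2.9 / N2.8.1 of route/T5-N2-route-3.md. Files 169 and 174 stated the lane's
consumers of Landherr's uniqueness on the two O'Meara displays `OMeara1963_66_1 K⁺` + `OMeara1963_63_19 K⁺`; with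
file 177's `grossBH2021_of_OMeara66_1` the second display is no longer needed anywhere:
* **`grossBH2021_Fin2_of_OMeara66_1`** (rank 2) and **`shimura2008_Thm2_2_i_of_OMeara66_1`** — t6-p5's display
  `T6.Hyp.Shimura2008_Thm2_2_i K` from the Hasse–Minkowski display alone (file 161's display implication);
* the general-rank Gram-form statements of file 174 (`isCongruent_of_det_eq_mul_norm_OMeara66_1'`,
  `isCongruent_of_det_eq_OMeara66_1'`, `isCongruent_iff_invariants_OMeara66_1'`, `isCongruent_of_chain_OMeara66_1'`,
  `isCongruent_of_chain_K7_OMeara66_1'`);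
* Lemma N.2's conclusions of file 169 (`isIsometric_of_OMeara66_1`, `adm_of_OMeara66_1`, `ofSpec_adm_OMeara66_1`,
  `N2_main_ofSpec_OMeara66_1`, `N2_main_OMeara66_1`, `N2_main₃_OMeara66_1`) — t6-p5's `N2Main` / `N2Contract` /
  `N2Contract3` conclusions consumed by name.
STATE OF THE LANE: Lemma N.1 / N.2's isometry on the datum of record, N2's general-datum route, Landherr's
theorem in every rank and Shimura's Theorem 2.2 (i) are kernel modulo ONE printed statement — the Hasse–Minkowski
theorem (O'Meara 66:1, isotropy form, «if» half, totally real base field). Nothing here is consumed by the M-chain.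

Mathlib + t6-p5's accepted T6N2Hyp / T6N2Main / T6N2Contract / T6N2Contract3 (consumed by name) + this seat's files
161 / 169 / 174 / 177 and their imports; no new display; no device. §8(d): uses an L-value-free non-vanishing
device: NO.
-/

namespace Summit.Ventures.HodgeRepro2.T5LandherrOfHasseMinkowskiHM

open Summit.Ventures.HodgeRepro2 Summit.Ventures.HodgeRepro2.T6 Summit.Ventures.HodgeRepro2.T5DatumSimilitude
  Summit.Ventures.HodgeRepro2.T5CubeTypes Summit.Ventures.HodgeRepro2.T5HermitianDetClass
  Summit.Ventures.HodgeRepro2.T5HermitianGlobalChain Summit.Ventures.HodgeRepro2.T5HasseMinkowskiDisplays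
  Summit.Ventures.HodgeRepro2.T5LandherrInvariants Summit.Ventures.HodgeRepro2.T5LandherrInvariantsIff
  Summit.Ventures.HodgeRepro2.T5LandherrGeneralHM
open IsDedekindDomain IsDedekindDomain.HeightOneSpectrum NumberField NumberField.IsCMField Matrix

section Landherr

variable {K : Type*} [Field K] [NumberField K] [NumberField.IsCMField K]

/-- **LANDHERR'S THEOREM IN RANK 2 FROM THE HASSE–MINKOWSKI DISPLAY ALONE** (file 177 at `n = Fin 2`). -/
theorem grossBH2021_Fin2_of_OMeara66_1 (hHM : OMeara1963_66_1 (maximalRealSubfield K)) :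
    GrossBH2021_Thm3_1_uniqueness K (Fin 2) :=
  grossBH2021_of_OMeara66_1 hHM (Fin 2)

/-- **SHIMURA'S THEOREM 2.2 (i) — t6-p5's display — FROM THE HASSE–MINKOWSKI DISPLAY ALONE** (file 161's
`shimura2008_Thm2_2_i_of_grossBH2021` on the rank-2 case). -/
theorem shimura2008_Thm2_2_i_of_OMeara66_1 (hHM : OMeara1963_66_1 (maximalRealSubfield K)) :
    Summit.Ventures.HodgeRepro2.T6.Hyp.Shimura2008_Thm2_2_i K :=
  shimura2008_Thm2_2_i_of_grossBH2021 (grossBH2021_Fin2_of_OMeara66_1 hHM)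

end Landherr

/-! ## The general-rank Gram-form statements of file 174 -/

section General

variable {K : Type*} [Field K] [NumberField K] [IsCMField K]

/-- Theorem 2.2 (i) in Gram form, every rank, from the Hasse–Minkowski display alone (file 161's
`isCongruent_of_det_eq_mul_norm`). -/
theorem isCongruent_of_det_eq_mul_norm_OMeara66_1' (hHM : OMeara1963_66_1 (maximalRealSubfield K))
    {n : Type*} [Fintype n] [DecidableEq n]
    {H H' : Matrix n n K} (hH : H.IsHermitian) (hH' : H'.IsHermitian) (hdet : IsUnit H.det)
    (hdet' : IsUnit H'.det) (z : K) (hz : H'.det = z * star z * H.det)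
    (hreal : ∀ φ : K →+* ℂ, IsCongruent (H.map φ) (H'.map φ)) : IsCongruent H H' :=
  isCongruent_of_det_eq_mul_norm hH hH' hdet hdet' z hz hreal (grossBH2021_of_OMeara66_1 hHM n)

/-- The equal-determinant case, every rank (file 161's `isCongruent_of_det_eq`). -/
theorem isCongruent_of_det_eq_OMeara66_1' (hHM : OMeara1963_66_1 (maximalRealSubfield K))
    {n : Type*} [Fintype n] [DecidableEq n]
    {H H' : Matrix n n K} (hH : H.IsHermitian) (hH' : H'.IsHermitian) (hdet : IsUnit H.det)
    (hdet' : IsUnit H'.det) (hdeq : H'.det = H.det)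
    (hreal : ∀ φ : K →+* ℂ, IsCongruent (H.map φ) (H'.map φ)) : IsCongruent H H' :=
  isCongruent_of_det_eq hH hH' hdet hdet' hdeq hreal (grossBH2021_of_OMeara66_1 hHM n)

/-- Theorem 2.2 (i) as an `iff` in Gram form, every rank, from the Hasse–Minkowski display alone (file 163's
`isCongruent_iff_invariants`). -/
theorem isCongruent_iff_invariants_OMeara66_1' (hHM : OMeara1963_66_1 (maximalRealSubfield K))
    {n : Type*} [Fintype n] [DecidableEq n]
    {H H' : Matrix n n K} (hH : H.IsHermitian) (hH' : H'.IsHermitian) (hdet : IsUnit H.det)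
    (hdet' : IsUnit H'.det) :
    IsCongruent H H' ↔
      ((∃ z : K, z ≠ 0 ∧ H'.det = z * star z * H.det) ∧
        ∀ φ : K →+* ℂ, IsCongruent (H.map φ) (H'.map φ)) :=
  isCongruent_iff_invariants hH hH' hdet hdet' (grossBH2021_of_OMeara66_1 hHM n)

/-- File 156's general chain (`isCongruent_of_chain`) in every rank, with Landherr's display replaced by the Hasse–Minkowski
display alone. -/
theorem isCongruent_of_chain_OMeara66_1' (hHM : OMeara1963_66_1 (maximalRealSubfield K))
    {θ : maximalRealSubfield K} {y : K}
    (hθ : algebraMap (maximalRealSubfield K) K θ = y ^ 2) (hy : complexConj K y ≠ y)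
    {n : Type*} [Fintype n] [DecidableEq n] {H H' : Matrix n n K}
    (hH : H.IsHermitian) (hH' : H'.IsHermitian) (hdet : IsUnit H.det) (hdet' : IsUnit H'.det)
    (hodd : ∀ v : HeightOneSpectrum (𝓞 (maximalRealSubfield K)),
      ¬ IsSquare (algebraMap (maximalRealSubfield K) (v.adicCompletion (maximalRealSubfield K)) θ) →
      IsUnit (2 : adicCompletionIntegers (maximalRealSubfield K) v) → LocallyCongruent K v H H')
    (hreal : ∀ φ : K →+* ℂ, IsCongruent (H.map φ) (H'.map φ))
    (hD : (dyadicNonSplit K (θ := θ)).Subsingleton)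
    (hrec : Summit.Ventures.HodgeRepro2.T6.Hyp.OMeara1963_71_18 (maximalRealSubfield K)) :
    IsCongruent H H' :=
  isCongruent_of_chain hθ hy hH hH' hdet hdet' hodd hreal hD hrec (grossBH2021_of_OMeara66_1 hHM n)

open Summit.Ventures.HodgeRepro2.CyclotomicSeven in
/-- File 156's chain on the field of record `ℚ(ζ₇)` (`isCongruent_of_chain_K7`) in every rank, on the Hasse–Minkowski display
alone. -/
theorem isCongruent_of_chain_K7_OMeara66_1' (hHM : OMeara1963_66_1 (maximalRealSubfield K7))
    {n : Type*} [Fintype n] [DecidableEq n]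
    {H H' : Matrix n n K7}
    (hH : H.IsHermitian) (hH' : H'.IsHermitian) (hdet : IsUnit H.det) (hdet' : IsUnit H'.det)
    (hodd : ∀ v : HeightOneSpectrum (𝓞 (maximalRealSubfield K7)),
      ¬ IsSquare (algebraMap (maximalRealSubfield K7) (v.adicCompletion (maximalRealSubfield K7)) (-7)) →
      IsUnit (2 : adicCompletionIntegers (maximalRealSubfield K7) v) → LocallyCongruent K7 v H H')
    (hreal : ∀ φ : K7 →+* ℂ, IsCongruent (H.map φ) (H'.map φ)) : IsCongruent H H' :=
  isCongruent_of_chain_K7 hH hH' hdet hdet' hodd hreal (grossBH2021_of_OMeara66_1 hHM n)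

end General

/-! ## Lemma N.2's conclusions (file 169) -/

section N2

variable {K : Type*} [Field K] [NumberField K] [NumberField.IsCMField K]
variable {F : FaceSetting K} {P : NDatum F} {𝒟 : N3Datum}

/-- (b2) `W_B ≅ W_A` from the Hasse–Minkowski display alone (t6-p5's `N2Main.isIsometric_of`). -/
theorem isIsometric_of_OMeara66_1 (D : N2Datum F P 𝒟) (hfr : IsCMFrame D.τ)
    (h₁₁₁ : IsLiuSignElement K (D.type t111) D.e₁₁₁)
    (h₁₀₀ : IsLiuSignElement K (D.type t100) D.e₁₀₀) (hu : N2Main.USpec D)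
    (hHM : OMeara1963_66_1 (maximalRealSubfield K)) :
    D.IsIsometric :=
  N2Main.isIsometric_of D hfr h₁₁₁ h₁₀₀ hu (shimura2008_Thm2_2_i_of_OMeara66_1 hHM)

/-- LEMMA N.2 ON THE DATUM from the Hasse–Minkowski display alone: `D.Adm` (t6-p5's `N2Main.adm_of`). -/
theorem adm_of_OMeara66_1 (D : N2Datum F P 𝒟) (hfr : IsCMFrame D.τ)
    (h₁₁₁ : IsLiuSignElement K (D.type t111) D.e₁₁₁)
    (h₁₀₀ : IsLiuSignElement K (D.type t100) D.e₁₀₀) (hu : N2Main.USpec D)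
    (hHM : OMeara1963_66_1 (maximalRealSubfield K)) :
    D.Adm :=
  N2Main.adm_of D hfr h₁₁₁ h₁₀₀ hu (shimura2008_Thm2_2_i_of_OMeara66_1 hHM)

/-- LEMMA N.2 on the explicit datum (t6-p5's `N2Main.ofSpec_adm`) from the Hasse–Minkowski display alone. -/
theorem ofSpec_adm_OMeara66_1 (F : FaceSetting K) (P : NDatum F) (𝒟 : N3Datum)
    {τ : Fin 3 → (K →+* ℂ)} (hfr : IsCMFrame τ) {e₁₁₁ e₁₀₀ : K}
    (h₁₁₁ : IsLiuSignElement K (cubeType τ t111) e₁₁₁)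
    (h₁₀₀ : IsLiuSignElement K (cubeType τ t100) e₁₀₀)
    (Char : Type) [CommGroup Char] (χ₁₁₁ χ₁₀₀ : Char)
    (admA : Set 𝒟.A.Sa) (admB : Set 𝒟.A.Sb) (admC : Set 𝒟.B.Sa) (admD : Set 𝒟.B.Sb)
    (hHM : OMeara1963_66_1 (maximalRealSubfield K)) :
    (N2Main.ofSpec F P 𝒟 hfr h₁₁₁ h₁₀₀ Char χ₁₁₁ χ₁₀₀ admA admB admC admD).Adm :=
  N2Main.ofSpec_adm F P 𝒟 hfr h₁₁₁ h₁₀₀ Char χ₁₁₁ χ₁₀₀ admA admB admC admD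
    (shimura2008_Thm2_2_i_of_OMeara66_1 hHM)

/-- `N2_main_ofSpec` over the v2 carrier (t6-p5's `N2Contract.N2_main_ofSpec`) from the Hasse–Minkowski display alone. -/
theorem N2_main_ofSpec_OMeara66_1 (M : NAut2 F P)
    {τ : Fin 3 → (K →+* ℂ)} (hfr : IsCMFrame τ) {e₁₁₁ e₁₀₀ : K}
    (h₁₁₁ : IsLiuSignElement K (cubeType τ t111) e₁₁₁)
    (h₁₀₀ : IsLiuSignElement K (cubeType τ t100) e₁₀₀)
    (Char : Type) [CommGroup Char] (χ₁₁₁ χ₁₀₀ : Char)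
    (admA : Set M.d3.A.Sa) (admB : Set M.d3.A.Sb) (admC : Set M.d3.B.Sa) (admD : Set M.d3.B.Sb)
    (hd2 : M.d2 = N2Main.ofSpec F P M.d3 hfr h₁₁₁ h₁₀₀ Char χ₁₁₁ χ₁₀₀ admA admB admC admD)
    (hHM : OMeara1963_66_1 (maximalRealSubfield K)) :
    M.AdmDatum :=
  N2Contract.N2_main_ofSpec M hfr h₁₁₁ h₁₀₀ Char χ₁₁₁ χ₁₀₀ admA admB admC admD hd2
    (shimura2008_Thm2_2_i_of_OMeara66_1 hHM)

/-- `N2_main` over the v2 carrier `NAut2` (t6-p5's `N2Contract.N2_main`) from the Hasse–Minkowski display alone. -/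
theorem N2_main_OMeara66_1 (M : NAut2 F P) (hfr : IsCMFrame M.d2.τ)
    (h₁₁₁ : IsLiuSignElement K (M.d2.type t111) M.d2.e₁₁₁)
    (h₁₀₀ : IsLiuSignElement K (M.d2.type t100) M.d2.e₁₀₀)
    (hu : N2Main.USpec M.d2)
    (hHM : OMeara1963_66_1 (maximalRealSubfield K)) :
    M.AdmDatum :=
  N2Contract.N2_main M hfr h₁₁₁ h₁₀₀ hu (shimura2008_Thm2_2_i_of_OMeara66_1 hHM)

/-- `N2_main₃` over the re-cut carrier `NAut3` (t6-p5's `N2Contract3.N2_main₃`) from the Hasse–Minkowski display alone. -/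
theorem N2_main₃_OMeara66_1 (M : NAut3 F P) (hfr : IsCMFrame M.d2.τ)
    (h₁₁₁ : IsLiuSignElement K (M.d2.type t111) M.d2.e₁₁₁)
    (h₁₀₀ : IsLiuSignElement K (M.d2.type t100) M.d2.e₁₀₀)
    (hu : N2Main.USpec M.d2)
    (hHM : OMeara1963_66_1 (maximalRealSubfield K)) :
    M.AdmDatum :=
  N2Contract3.N2_main₃ M hfr h₁₁₁ h₁₀₀ hu (shimura2008_Thm2_2_i_of_OMeara66_1 hHM)

end N2

end Summit.Ventures.HodgeRepro2.T5LandherrOfHasseMinkowskiHM
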